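import Summits.QuantumFields.BalabanUV.Beta.KernelWardHColumnWall
import Summits.QuantumFields.BalabanUV.Beta.GAN24.CoDressedColumnSourceSums
import Summits.QuantumFields.BalabanUV.Beta.GAN24.ResolventLegCharges

/-!
# `BalabanUV.Beta.GAN24.CombKernelSheetResponse` — binder row G-an2-4 ∕ (CONV-C), W-slot CT-W, route «WC-TL», the table fact «3F-REC» (this lineage's
# `SpureRecSlotChargeThreeFace` ∕ `SpureRecLegChargeThreeFace`: «S3C-REC» ⟸ «3F-REC»), the letter (FF) of its induction:
# **THE SHEET LAW OF THE COMB KERNEL — the `ℋ`-column response of `G_j = coDressKBmAt ρ Lc (KInvStep Lc j)` to the uniform background on ONE coarse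
# hyperplane of direction-`α` bonds is EXACTLY the exit-face indicator of the blocks on that hyperplane** (derived from the tree's `ℋ`-column Ward law)

NOT IN PRINT; OUR BOOKKEEPING ([folklore] lattice bookkeeping BY NAME; G-an2-4 formalisation swarm, leaf prover `b2b-balaban-gan24-formalise-leaf-04`, gen 62; journal
INTENT I-leaf04-g62-2 «(FF) SHEET ∕ FACE RESPONSE»; names PROVISIONAL).  HONEST FRAMING (cell contract, verbatim): «discharging `BetaPertH` makes Bałaban's UV
stability UNCONDITIONAL — a real constructive-QFT result; it is NOT the continuum limit and NOT the Clay problem.»  HONEST DEPENDENCY (verbatim): «continuum YM on T⁴ ⇐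
BetaPertH ∧ nine spine estimates (0/9 proved); BetaPertH ⇐ (D1) ∧ (D4) ∧ CAP+tail; G-an2-4 gates asym, D1 and NE2/3/4.»

WHY.  The three-face-legs cell law «3F-REC» unrolls level by level IF the comb kernel maps exit-face backgrounds to exit-face forms (engine R-leaf04-g62-4:
exactly, coefficient `∓Lc·σ_j` for every period `P`; the undressed `KInvStep` does not).  The coarse exit-face background of period `P` is a sum of SHEETS
`S_m := [x″_α = m]`; so the content is the single-sheet response.  The tree's `ℋ`-COLUMN WARD LAW `KernelWardHColumnWall.colH_ward_KInvStep_all` (an1 ∕ an2: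
`Σ_μ (colH G_j Lc μ (Y − e_μ) κ u − colH G_j Lc μ Y κ u) = cH_j · gaugeWt Lc Y κ u`, `gaugeWt = [blk(u + e_κ) = Y] − [blk u = Y]` — the response to the coarse pure
gauge `dδ_Y` is `cH_j` times the fine pure gauge `d𝟙_{B(Y)}`), SUMMED over the coarse hyperplane `{Y : Y_α = m+1}` (directions `μ ≠ α` cancel by re-indexing; the
block indicators see at most one block), gives the SHEET-DIFFERENCE LAW `R(m) − R(m+1) = cH_j·([blk(u+e_κ)_α = m+1] − [blk u_α = m+1])` for the sheet responses
`R(m) := Σ'_{y : y_α = m} colH G_j Lc α y κ u`.  The exit-face indicator `D(m) := cH_j·[κ = α]·[u_α % Lc = Lc−1]·[u_α ∕ Lc = m]` solves the same difference law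
(gan24-p4's `PiBmConstants.int_succ_ediv`: `(a+1)∕L = a∕L + [a % L = L−1]`), the difference `R − D` is constant in `m`, and it is SUMMABLE over `m ∈ ℤ` (sheet sums of the summable column family — decay of
`G_j`, an2's `decays_coDressKBmAt_KInvStep`; slicing `ℤ^{d+1} ≃ ℤ × ℤ^d` along `α`, `Fin.insertNthEquiv`); a summable constant is zero.  HENCE

  `Σ'_{y : y_α = m} colH G_j Lc α y κ u = cH_j · [κ = α] · [u_α % Lc = Lc−1] · [u_α ∕ Lc = m]`,  `cH_j = (stepScale d Lc j · Lc^{d+1})⁻¹ (= Lc·σ_j)`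

— no tails off the sheet's own exit face.  The period-`P` face laws (columns and rows, every `P`) are the sequel `CombKernelFaceResponse`.

WHAT ([folklore]; 0 `def`, 0 cited facts, 0 `def … : Prop`, 0 sorry; generic `d`, every `j`, every in-block root):
* §1 `coDressKBmAt_KInvStep_inr_inl_eq_neg_colH` — the `(inr α, inl a)` ROWS of the comb kernel at coarse points are MINUS its `ℋ`-columns (leaf-02 g51's
  `rowH_coDressKBmAt` + an4's `KInvStep_inr_inl_eq_neg`).
* §2 `summable_colH_comb`, `summable_colH_comb_sheet` (decay).
* §3 `add_unitVec_apply`, `tsum_sheet_point`, **`sheet_sub_sheet_succ`** (the sheet-difference law from the summed Ward law).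
* §4 `insertNthEquiv_apply_same`, `tsum_sheet_eq_fibre`, `summable_tsum_sheet` (sheet sums = fibre sums along `α`; summable in the sheet index), `eq_zero_of_summable_const`,
  **`tsum_colH_sheet`** ∕ **`hasSum_colH_sheet`** (THE SHEET LAW).
ENGINE (DIAG-ONLY; R-leaf04-g62-4, kit j157820): the period-`P` consequences hold to 1e-15 at D = 2 (P = 1, 3, 9; j = 0, 1).  Asserts NO value of Bałaban's tables beyond
the tree's Ward constant `cH_j`; discharges NOTHING of «3F-REC» ∕ «S3C-REC» ∕ F2a-comb ∕ (C)sym ∕ (Q-D) ∕ (Q-D-rate) ∕ «T2Shape» ∕ «T2Drift» ∕ (hW, hWall); NOT «D1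
closed»; NEVER «G-an2-4 closed» as (CONV-C); NOT D1, NOT `BetaPertH`, NOT continuum, NOT Clay.  2026-08-22; no existing file touched.
-/

noncomputable section

open Finset Filter
open scoped BigOperators Topology
open Literature.MathematicalPhysics.QuantumFieldTheory
open Literature.MathematicalPhysics.QuantumFieldTheory.Balaban1983to89
open Literature.MathematicalPhysics.QuantumFieldTheory.Balaban1983to89.Beta
open B12Sec2to5 (l1 l1_nonneg)
open B6BondElimination (unitVec unitVec_apply)
open ExpKernelCalculus (Site MKer Decays)
open AffineAveraging (box toSite)
open AveragingContours (blk)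
open OneStepResolventKernel (Fib)
open OneStepKernelFamily (KInvStep colH abs_colH_le)
open Summit.QuantumFields.BalabanUV.Beta.AxialDressingRooted (coDressKBmAt decays_coDressKBmAt_KInvStep pmBm cube coProjBmW coProjBmW_apply colH_coDressKBmAt_eq)
open Summit.QuantumFields.BalabanUV.Beta.BorderedHessian (stepScale)
open Summit.QuantumFields.BalabanUV.Beta.KernelWardRelative (gaugeWt)
open Summit.QuantumFields.BalabanUV.Beta.KernelWardHColumnWall (colH_ward_KInvStep_all)
open Summit.QuantumFields.BalabanUV.Beta.GAN24.CoDressedColumnSourceSums (rowH_coDressKBmAt)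
open Summit.QuantumFields.BalabanUV.Beta.GAN24.LinT2ZeroModeStep (KInvStep_inr_inl_eq_neg)
open Summit.QuantumFields.BalabanUV.Beta.GAN24.ResolventLegCharges (summable_exp_coarse')
open Summit.QuantumFields.BalabanUV.Beta.GAN24.PiBmConstants (int_succ_ediv)

namespace Summit.QuantumFields.BalabanUV.Beta.GAN24.CombKernelSheetResponse

variable {d : ℕ} {Lc : ℕ} [NeZero Lc]

/-! ## §1 Rows of the comb kernel are minus its `ℋ`-columns -/

/-- [folklore] **THE (inr α, inl a) ROWS OF THE COMB KERNEL ARE MINUS ITS `ℋ`-COLUMNS**: for `G_j = coDressKBmAt ρ Lc (KInvStep Lc j)`,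
`G_j x y (inr α) (inl a) = −colH (G_j′) …` — precisely `coDressKBmAt ρ Lc K x y (inr α) (inl a) = −(coProjBmW ρ Lc (fun κ t => K t x (inl κ) (inr α))) a y`
for `K = KInvStep Lc j` (leaf-02 g51's `rowH_coDressKBmAt` + an4's `ℋ♭ = −ℋᵀ`, `KInvStep_inr_inl_eq_neg`); at a coarse row `x = Lc•x″` this is
`−colH G_j Lc α x″ a y`. -/
theorem coDressKBmAt_KInvStep_inr_inl_eq_neg_colH (ρ : Fin (d + 1) → ℤ) (j : ℕ) (x'' y : Site (d + 1)) (α a : Fin (d + 1)) :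
    coDressKBmAt ρ Lc (KInvStep (d := d) Lc j) ((Lc : ℤ) • x'') y (Sum.inr α) (Sum.inl a)
      = -colH (coDressKBmAt ρ Lc (KInvStep (d := d) Lc j)) Lc α x'' a y := by
  rw [rowH_coDressKBmAt, congrFun (congrFun (colH_coDressKBmAt_eq ρ Lc (KInvStep (d := d) Lc j) α x'') a) y, coProjBmW_apply,
    ← Finset.sum_neg_distrib]
  refine Finset.sum_congr rfl fun v _ => ?_
  rw [← Finset.sum_neg_distrib]
  refine Finset.sum_congr rfl fun κ _ => ?_
  rw [colH, KInvStep_inr_inl_eq_neg]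
  ring

/-! ## §2 The sheet sums of an `ℋ`-column family: summability -/

section Sheet

variable {r : Fin (d + 1) → ℕ}

/-- [folklore] The `ℋ`-column family of the comb kernel at a FIXED fine bond is summable over the coarse source. -/
theorem summable_colH_comb (hr : r ∈ box (d + 1) Lc) (j : ℕ) (μ κ : Fin (d + 1)) (u : Site (d + 1)) :
    Summable fun y : Site (d + 1) => colH (coDressKBmAt (toSite r) Lc (KInvStep (d := d) Lc j)) Lc μ y κ u := by
  obtain ⟨δ, C, hδ, hC, hG⟩ := decays_coDressKBmAt_KInvStep (d := d) hr j
  refine Summable.of_norm_bounded ((summable_exp_coarse' (d := d) (N := Lc) NeZero.one_le hδ u).mul_left C) fun y => ?_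
  rw [Real.norm_eq_abs]
  exact abs_colH_le (N := Lc) hG μ y κ u

/-- [folklore] The sheet-restricted family (coarse sources on the hyperplane `y_α = m`) is summable. -/
theorem summable_colH_comb_sheet (hr : r ∈ box (d + 1) Lc) (j : ℕ) (μ κ : Fin (d + 1)) (u : Site (d + 1)) (α : Fin (d + 1)) (m : ℤ) :
    Summable fun y : Site (d + 1) =>
      if y α = m then colH (coDressKBmAt (toSite r) Lc (KInvStep (d := d) Lc j)) Lc μ y κ u else 0 := by
  refine Summable.of_norm_bounded (summable_colH_comb hr j μ κ u).norm fun y => ?_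
  split_ifs
  · exact le_rfl
  · rw [norm_zero]; exact norm_nonneg _

end Sheet


/-! ## §3 The sheet-difference law: the `ℋ`-column Ward law summed over a coarse hyperplane -/

section Diff

variable {r : Fin (d + 1) → ℕ}

omit [NeZero Lc] in
/-- [folklore] the `α`-coordinate of a unit step: `(u + e_κ) α = u α + [α = κ]`. -/
theorem add_unitVec_apply (u : Site (d + 1)) (κ α : Fin (d + 1)) : (u + unitVec κ) α = u α + (if α = κ then 1 else 0) := by
  simp only [Pi.add_apply, unitVec_apply]

omit [NeZero Lc] in
/-- [folklore] a point-supported indicator under a sheet indicator: `Σ'_y [y_α = m]·[v = y] = [v_α = m]`. -/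
theorem tsum_sheet_point (v : Site (d + 1)) (α : Fin (d + 1)) (m : ℤ) :
    ∑' y : Site (d + 1), (if y α = m then (if v = y then (1 : ℝ) else 0) else 0) = if v α = m then 1 else 0 := by
  have e : (fun y : Site (d + 1) => (if y α = m then (if v = y then (1 : ℝ) else 0) else 0)) = fun y => if y = v then (if v α = m then 1 else 0) else 0 := by
    funext y
    by_cases hy : y = v
    · subst hy; simp
    · simp [hy, Ne.symm hy]
  rw [e, tsum_ite_eq]

/-- NOT IN PRINT; OUR BOOKKEEPING ([folklore] the tree's `ℋ`-column Ward law `KernelWardHColumnWall.colH_ward_KInvStep_all` summed over the coarse hyperplane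
`{Y : Y_α = m+1}`).  **THE SHEET-DIFFERENCE LAW**: with `R(m) := Σ'_{y : y_α = m} colH G_j Lc α y κ u` (the `ℋ`-column response at the fine bond `(κ, u)` to the
uniform background on ONE coarse hyperplane of direction-`α` bonds),
`R(m) − R(m+1) = cH_j · ([blk (u + e_κ)_α = m+1] − [blk u_α = m+1])`, `cH_j = (stepScale d Lc j · Lc^{d+1})⁻¹` — the sum over the hyperplane of the pure
gauges `dδ_Y` is the difference of two adjacent sheets (directions `μ ≠ α` cancel by re-indexing), and the sum of the block responses `gaugeWt Lc Y κ u` sees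
at most one block. -/
theorem sheet_sub_sheet_succ (hr : r ∈ box (d + 1) Lc) (j : ℕ) (α κ : Fin (d + 1)) (u : Site (d + 1)) (m : ℤ) :
    (∑' y : Site (d + 1), (if y α = m then colH (coDressKBmAt (toSite r) Lc (KInvStep (d := d) Lc j)) Lc α y κ u else 0))
      - (∑' y : Site (d + 1), (if y α = m + 1 then colH (coDressKBmAt (toSite r) Lc (KInvStep (d := d) Lc j)) Lc α y κ u else 0))
      = (stepScale d Lc j * (Lc : ℝ) ^ (d + 1))⁻¹ *
          ((if blk Lc (u + unitVec κ) α = m + 1 then (1 : ℝ) else 0) - (if blk Lc u α = m + 1 then (1 : ℝ) else 0)) := by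
  set G := coDressKBmAt (toSite r) Lc (KInvStep (d := d) Lc j) with hG
  set cH : ℝ := (stepScale d Lc j * (Lc : ℝ) ^ (d + 1))⁻¹ with hcH
  -- the Ward law, pointwise in the coarse bond
  have hW : ∀ y : Site (d + 1), ∑ μ, (colH G Lc μ (y - unitVec μ) κ u - colH G Lc μ y κ u) = cH * gaugeWt Lc y κ u :=
    fun y => colH_ward_KInvStep_all (d := d) hr j y κ u
  -- summability of the sheet families, every direction, shifted or not
  have hs : ∀ (μ : Fin (d + 1)) (m' : ℤ), Summable fun y : Site (d + 1) => if y α = m' then colH G Lc μ y κ u else 0 :=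
    fun μ m' => summable_colH_comb_sheet hr j μ κ u α m'
  have hshift : ∀ μ : Fin (d + 1),
      (∑' y : Site (d + 1), (if y α = m + 1 then colH G Lc μ (y - unitVec μ) κ u else 0))
        = ∑' y : Site (d + 1), (if y α + (if α = μ then 1 else 0) = m + 1 then colH G Lc μ y κ u else 0) := by
    intro μ
    rw [← (Equiv.addRight (unitVec μ)).tsum_eq (fun y : Site (d + 1) => if y α = m + 1 then colH G Lc μ (y - unitVec μ) κ u else 0)]
    refine tsum_congr fun y => ?_
    simp only [Equiv.coe_addRight, add_sub_cancel_right, add_unitVec_apply]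
  have hss : ∀ μ : Fin (d + 1), Summable fun y : Site (d + 1) => if y α = m + 1 then colH G Lc μ (y - unitVec μ) κ u else 0 := by
    intro μ
    have h0 : Summable fun y : Site (d + 1) => colH G Lc μ (y - unitVec μ) κ u :=
      (Equiv.subRight (unitVec μ)).summable_iff.2 (summable_colH_comb hr j μ κ u)
    refine Summable.of_norm_bounded h0.norm fun y => ?_
    split_ifs
    · exact le_rfl
    · rw [norm_zero]; exact norm_nonneg _
  -- LHS of the summed Ward law
  have hL : (∑' y : Site (d + 1), (if y α = m + 1 then ∑ μ, (colH G Lc μ (y - unitVec μ) κ u - colH G Lc μ y κ u) else 0))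
      = (∑' y : Site (d + 1), (if y α = m then colH G Lc α y κ u else 0))
        - (∑' y : Site (d + 1), (if y α = m + 1 then colH G Lc α y κ u else 0)) := by
    have e1 : (fun y : Site (d + 1) => (if y α = m + 1 then ∑ μ, (colH G Lc μ (y - unitVec μ) κ u - colH G Lc μ y κ u) else 0))
        = fun y => ∑ μ, ((if y α = m + 1 then colH G Lc μ (y - unitVec μ) κ u else 0) - (if y α = m + 1 then colH G Lc μ y κ u else 0)) := by
      funext y
      split_ifs
      · rfl
      · simp
    rw [e1, Summable.tsum_finsetSum (fun μ _ => (hss μ).sub (hs μ (m + 1)))]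
    rw [Finset.sum_eq_single α]
    · rw [(hss α).tsum_sub (hs α (m + 1)), hshift α]
      simp only [if_true]
      congr 1
      refine tsum_congr fun y => ?_
      simp only [add_left_inj]
    · intro μ _ hμ
      rw [(hss μ).tsum_sub (hs μ (m + 1)), hshift μ]
      simp only [Ne.symm hμ, if_false, add_zero, sub_self]
    · intro h; exact absurd (Finset.mem_univ α) h
  -- RHS of the summed Ward law
  have hR : (∑' y : Site (d + 1), (if y α = m + 1 then cH * gaugeWt Lc y κ u else 0))
      = cH * ((if blk Lc (u + unitVec κ) α = m + 1 then (1 : ℝ) else 0) - (if blk Lc u α = m + 1 then (1 : ℝ) else 0)) := by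
    have e1 : (fun y : Site (d + 1) => (if y α = m + 1 then cH * gaugeWt Lc y κ u else 0))
        = fun y => cH * (if y α = m + 1 then (if blk Lc (u + unitVec κ) = y then (1 : ℝ) else 0) else 0)
            - cH * (if y α = m + 1 then (if blk Lc u = y then (1 : ℝ) else 0) else 0) := by
      funext y
      simp only [gaugeWt]
      split_ifs <;> ring
    rw [e1, Summable.tsum_sub, tsum_mul_left, tsum_mul_left, tsum_sheet_point, tsum_sheet_point, mul_sub]
    · exact (summable_of_ne_finset_zero (s := {blk Lc (u + unitVec κ)}) (fun y hy => by
        rw [Finset.mem_singleton] at hy; simp [Ne.symm hy])).mul_left cH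
    · exact (summable_of_ne_finset_zero (s := {blk Lc u}) (fun y hy => by
        rw [Finset.mem_singleton] at hy; simp [Ne.symm hy])).mul_left cH
  have hWs : (fun y : Site (d + 1) => (if y α = m + 1 then ∑ μ, (colH G Lc μ (y - unitVec μ) κ u - colH G Lc μ y κ u) else 0))
      = fun y => if y α = m + 1 then cH * gaugeWt Lc y κ u else 0 := by
    funext y; rw [hW y]
  rw [← hL, hWs, hR]

end Diff


/-! ## §4 The sheet law: a summable solution of the difference law is the exit-face indicator -/

section SheetLaw

variable {r : Fin (d + 1) → ℕ}

omit [NeZero Lc] in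
/-- [folklore] the insertion equivalence along the coordinate `α` (`Fin.insertNthEquiv`) puts the sheet index at `α`. -/
theorem insertNthEquiv_apply_same (α : Fin (d + 1)) (p : ℤ × (Fin d → ℤ)) :
    (Fin.insertNthEquiv (fun _ : Fin (d + 1) => ℤ) α p) α = p.1 := by
  simp [Fin.insertNthEquiv]

omit [NeZero Lc] in
/-- [folklore] **FIBRE SUMS ALONG ONE COORDINATE**: for a summable `f` on `ℤ^{d+1}`, the sheet sum `Σ'_{y : y_α = m} f y` is the fibre sum of `f` sliced along
`α` (through `Fin.insertNthEquiv`). -/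
theorem tsum_sheet_eq_fibre {f : Site (d + 1) → ℝ} (hf : Summable f) (α : Fin (d + 1)) (m : ℤ) :
    ∑' y : Site (d + 1), (if y α = m then f y else 0)
      = ∑' rest : Fin d → ℤ, f (Fin.insertNthEquiv (fun _ : Fin (d + 1) => ℤ) α (m, rest)) := by
  set E := Fin.insertNthEquiv (fun _ : Fin (d + 1) => ℤ) α with hE
  have hg : Summable (f ∘ ⇑E) := E.summable_iff.2 hf
  rw [← E.tsum_eq (fun y : Site (d + 1) => if y α = m then f y else 0)]
  have e1 : (fun p : ℤ × (Fin d → ℤ) => (if (E p) α = m then f (E p) else 0)) = fun p => if p.1 = m then (f ∘ ⇑E) p else 0 := by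
    funext p
    rw [insertNthEquiv_apply_same]
    rfl
  rw [e1]
  have hF : Summable fun p : ℤ × (Fin d → ℤ) => if p.1 = m then (f ∘ ⇑E) p else 0 := by
    refine Summable.of_norm_bounded hg.norm fun p => ?_
    split_ifs
    · exact le_rfl
    · rw [norm_zero]; exact norm_nonneg _
  have hFf : ∀ m' : ℤ, Summable fun rest : Fin d → ℤ => if (m', rest).1 = m then (f ∘ ⇑E) (m', rest) else 0 := by
    intro m'
    by_cases h : m' = m
    · simp only [h, if_true]; exact hg.prod_factor m
    · simp only [h, if_false]; exact summable_zero
  rw [hF.tsum_prod' hFf]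
  have e2 : ∀ m' : ℤ, (∑' rest : Fin d → ℤ, (if (m', rest).1 = m then (f ∘ ⇑E) (m', rest) else 0))
      = if m' = m then ∑' rest : Fin d → ℤ, (f ∘ ⇑E) (m, rest) else 0 := by
    intro m'
    by_cases h : m' = m
    · subst h; simp only [if_true]
    · simp only [h, if_false, tsum_zero]
  rw [tsum_congr e2, tsum_ite_eq]
  rfl

omit [NeZero Lc] in
/-- [folklore] The sheet sums of a summable family are summable over the sheet index. -/
theorem summable_tsum_sheet {f : Site (d + 1) → ℝ} (hf : Summable f) (α : Fin (d + 1)) :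
    Summable fun m : ℤ => ∑' y : Site (d + 1), (if y α = m then f y else 0) := by
  set E := Fin.insertNthEquiv (fun _ : Fin (d + 1) => ℤ) α with hE
  have hg : Summable (f ∘ ⇑E) := E.summable_iff.2 hf
  refine (hg.prod).congr fun m => ?_
  rw [tsum_sheet_eq_fibre hf α m]
  rfl

omit [NeZero Lc] in
/-- [folklore] a summable constant family over `ℤ` is zero. -/
theorem eq_zero_of_summable_const {c : ℝ} (h : Summable fun _ : ℤ => c) : c = 0 :=
  tendsto_const_nhds_iff.1 h.tendsto_cofinite_zero

/-- NOT IN PRINT; OUR BOOKKEEPING.  **THE SHEET LAW OF THE COMB KERNEL («FACES ↦ FACES», single sheet)**: for every level `j`, in-block root `r`, directions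
`α, κ`, fine bond base `u` and sheet index `m`,
`Σ'_{y : y_α = m} colH G_j Lc α y κ u = cH_j · [κ = α] · [u_α % Lc = Lc−1] · [u_α ∕ Lc = m]`, `G_j = coDressKBmAt (toSite r) Lc (KInvStep Lc j)`,
`cH_j = (stepScale d Lc j · Lc^{d+1})⁻¹`: the response of the comb kernel's `ℋ`-columns to the uniform background on ONE coarse hyperplane of direction-`α` bonds is
EXACTLY the exit-face indicator of the blocks on that hyperplane — zero on every other bond, no tails (the undressed `KInvStep` smears it).  Proof: §3's difference law
is solved by this indicator; the difference of the two solutions is constant in `m` and summable over `m ∈ ℤ` (sheet sums of a summable family), hence zero. -/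
theorem tsum_colH_sheet (hr : r ∈ box (d + 1) Lc) (j : ℕ) (α κ : Fin (d + 1)) (u : Site (d + 1)) (m : ℤ) :
    ∑' y : Site (d + 1), (if y α = m then colH (coDressKBmAt (toSite r) Lc (KInvStep (d := d) Lc j)) Lc α y κ u else 0)
      = (stepScale d Lc j * (Lc : ℝ) ^ (d + 1))⁻¹ *
          ((if κ = α then (1 : ℝ) else 0) * (if u α % (Lc : ℤ) = (Lc : ℤ) - 1 then (1 : ℝ) else 0) * (if u α / (Lc : ℤ) = m then (1 : ℝ) else 0)) := by
  set R : ℤ → ℝ := fun m => ∑' y : Site (d + 1),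
    (if y α = m then colH (coDressKBmAt (toSite r) Lc (KInvStep (d := d) Lc j)) Lc α y κ u else 0) with hRdef
  set D : ℤ → ℝ := fun m => (stepScale d Lc j * (Lc : ℝ) ^ (d + 1))⁻¹ *
    ((if κ = α then (1 : ℝ) else 0) * (if u α % (Lc : ℤ) = (Lc : ℤ) - 1 then (1 : ℝ) else 0) *
    (if u α / (Lc : ℤ) = m then (1 : ℝ) else 0)) with hDdef
  have hLc0 : (0 : ℤ) < (Lc : ℤ) := by exact_mod_cast Nat.pos_of_ne_zero (NeZero.ne Lc)
  -- (1) both families solve the same difference law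
  have hRD : ∀ m : ℤ, R m - R (m + 1) = D m - D (m + 1) := by
    intro m
    have h := sheet_sub_sheet_succ hr j α κ u m
    have hb1 : blk Lc (u + unitVec κ) α = (u α + (if α = κ then 1 else 0)) / (Lc : ℤ) := by
      simp only [blk, add_unitVec_apply]
    have hb0 : blk Lc u α = u α / (Lc : ℤ) := by simp only [blk]
    show R m - R (m + 1) = D m - D (m + 1)
    simp only [hRdef, hDdef]
    rw [h, hb1, hb0, ← mul_sub]
    congr 1
    by_cases hκ : κ = α
    · subst hκ
      simp only [if_true, one_mul]
      rw [int_succ_ediv hLc0 (u κ)]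
      by_cases hfc : u κ % (Lc : ℤ) = (Lc : ℤ) - 1
      · simp only [hfc, if_true, one_mul]
        have e1 : (u κ / (Lc : ℤ) + 1 = m + 1) ↔ (u κ / (Lc : ℤ) = m) := by omega
        simp only [e1]
      · simp only [hfc, if_false, add_zero, sub_self, zero_mul]
    · have hακ : ¬ (α = κ) := fun h => hκ h.symm
      simp only [hκ, hακ, if_false, add_zero, sub_self, zero_mul]
  -- (2) hence their difference is constant in `m`
  have hconst : ∀ m : ℤ, R m - D m = R 0 - D 0 := by
    intro m
    induction m using Int.induction_on with
    | zero => rfl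
    | succ k ih =>
      have h := hRD (k : ℤ)
      rw [← ih]; linarith
    | pred k ih =>
      have h := hRD (-(k : ℤ) - 1)
      rw [show (-(k : ℤ) - 1 + 1) = -(k : ℤ) by ring] at h
      rw [← ih]; linarith
  -- (3) `R` is summable over `m` (sheet sums of a summable family), `D` is finitely supported
  have hRs : Summable R := summable_tsum_sheet (summable_colH_comb hr j α κ u) α
  have hDs : Summable D := by
    refine summable_of_ne_finset_zero (s := {u α / (Lc : ℤ)}) fun m hm => ?_
    rw [Finset.mem_singleton] at hm
    simp only [hDdef, Ne.symm hm, if_false, mul_zero]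
  -- (4) a summable constant is zero
  have hc : R 0 - D 0 = 0 := eq_zero_of_summable_const ((hRs.sub hDs).congr fun m => hconst m)
  have hm := hconst m
  rw [hc, sub_eq_zero] at hm
  simpa only [hRdef, hDdef] using hm

/-- NOT IN PRINT; OUR BOOKKEEPING.  **`HasSum` FORM OF THE SHEET LAW** (the sheet family is summable — `summable_colH_comb_sheet`). -/
theorem hasSum_colH_sheet (hr : r ∈ box (d + 1) Lc) (j : ℕ) (α κ : Fin (d + 1)) (u : Site (d + 1)) (m : ℤ) :
    HasSum (fun y : Site (d + 1) => if y α = m then colH (coDressKBmAt (toSite r) Lc (KInvStep (d := d) Lc j)) Lc α y κ u else 0)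
      ((stepScale d Lc j * (Lc : ℝ) ^ (d + 1))⁻¹ *
          ((if κ = α then (1 : ℝ) else 0) * (if u α % (Lc : ℤ) = (Lc : ℤ) - 1 then (1 : ℝ) else 0) * (if u α / (Lc : ℤ) = m then (1 : ℝ) else 0))) := by
  rw [← tsum_colH_sheet hr j α κ u m]
  exact (summable_colH_comb_sheet hr j α κ u α m).hasSum

end SheetLaw

end Summit.QuantumFields.BalabanUV.Beta.GAN24.CombKernelSheetResponse

end
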